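import Summits.QuantumFields.YangMills.Theorems.BalabanUVNodesN15PerCubeGreenKnit335Kernel
import Summits.QuantumFields.YangMills.Theorems.BalabanUVNodesN15PerCubeGreenJetBoth
import Summits.QuantumFields.YangMills.Theorems.BalabanUVNodesN15PerCubeGreenFineObjects
import Summits.QuantumFields.YangMills.Theorems.BalabanUVNodesN15TwoSpacingGluingCurvedKnitCovariantLandauEtaDefect
import Summits.QuantumFields.YangMills.Theorems.BalabanUVNodesN15CovariantAveragingTwoGrid
import HarnessLib

/-!
# N15 = NE2, road (c) — PROGRAMME (PC) «[B9] Sect. C FOR THE LANDAU LETTER WITH PER-CUBE GAUGES (3.35) AS PRINTED», (PC-E′): THE PER-CUBE FACES ON BOTH GRIDS OF THE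
# TWO-SPACING PAIRING BY TRANSPORT — Bałaban's operator `Δ_{R_U} + aQ*(U)Q(U) − D_U(I−R(U))D*_U` inverted with decay at the spacings `L^{−k}` AND `L^{−r}L^{−k}` under ONE
# constant block, and the entries 0 + `∇_U G′(U)` of (3.42) likewise (dag-n15-c g31, n15-c∕327)

Cell `pub-ymgap`, seat `pub-ymgap-dag-n15-c` (generation g31; R134 (a) seat, strategy s1 «first missing estimate»; HUMAN RULING D-0062; chair R424 venue).
`bears_on: R4∕N15 · K3⁸ SpineGivenEndpointR13SepCoPHV (stmt-QuantumFields-27366)`; filed `--kind proof --supports stmt-QuantumFields-27366 --as helper` — COUNT-NEUTRAL.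
Four theorems, 0 `def`, 0 `sorry`; TRANSPORT ∕ bookkeeping over landed theorems, NO new estimate.  Imports BY NAME n15-c∕323 `…PerCubeGreenKnit335Kernel` (through it n15-c∕321
`exists_inverse_decay_of_reg335Cube`, 323 `exists_inverse_kernelDecay_of_reg335Cube` and the coarse bond objects `CvX`∕`CvNorm`∕`cvBlk`∕`cvNL`∕`cvNVq`∕`cvNVr`), n15-c∕278
`…PerCubeGreenJetBoth` (`hasMaj_cGreen_jet_of_reg335Box2`), n15-c∕260′ `…PerCubeGreenFineObjects` (`ScX'`, `ScNorm'`, `scShift'`), n15-c `…TwoSpacingGluingCurvedKnitCovariantLandauEtaDefect`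
(the fine bond objects `CvX'`∕`cvNL'`∕`cvNVq'`∕`cvNVr'`∕`cvLandau'`) and n15-c `…CovariantAveragingTwoGrid` (`CovAvg.blockOf_kingPr`).  Nothing in the tree is modified, no landed
name re-declared.

WHY (HOME HANDOFF § g30 «FINE-TWIN CENSUS for (PC-E)» + «TRANSPORT IDEA»).  Every single-grid input of the two-spacing η-defect (PC-E) is needed on BOTH grids of the pairing —
the coarse torus `Tor (fine L^k (cvM))` and the fine torus `Tor (fine (L^r·L^k) (cvM))` (dag-n15-a's `kingPr L k r`, [King1986] p.664 «when x′ ∈ T_η′ we denote by x that point in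
T_η for which x′ ∈ Bⁿ(x)») — and with the SAME constants.  The census of g30 priced the fine editions of the per-cube R-part chain (jets 268–278, closeness 289–298, Sop 299a–j,
Landau letter 300–315, knit 316–323) at ≈ 40 generated twin files.  THIS FILE replaces that by a transport: the coarse chain's index is free, `cvM d L mv k hL = 2L^{m+1}` does not
depend on `k` (definitionally), the carrier geometry `unitTorusGeo L k (cvM)` enters `B11SectG.HasMaj` only through its `Site` and `dist` fields (definitionally equal for all `k`),
and the fine objects (`ScX'`, `scShift'`, `CvX'`, `cvNL'`, `cvNVq'`, `cvNVr'`, `cvLandau'`) are BY CONSTRUCTION the coarse ones with the spacing `L^k` replaced by `L^r·L^k` over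
n-generic primitives (`landauCov M n`, `qvCov M n`, `covLapM`, `cGreen M n`, `cgrad M n`, `knitG … n`, `chiCube M n`, `coverXi M n`, `blockOf n`, …).  So the coarse theorem AT INDEX
`r + k` IS the fine theorem at `(k, r)` after `L^{r+k} = L^r·L^k` (`pow_add`): in Lean, `delta`-unfold the k-indexed wrappers, `generalize_proofs` (the auto-generated proof constants
`NeZero (L^(r+k))`, `NeZero (fine (L^(r+k)) (cvM) μ)` are the only terms rigid in the exponent), `rw [pow_add]`, `exact` (defeq closes `cvM … (r+k)` vs `cvM … k` and the
geometry index).  Since the coarse constants are uniform in the index, BOTH grids come under ONE constant block — which is what a two-grid consumer needs and what two separate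
existential statements could not give it; hence the `_twoGrid` conjunctions below (coarse conjunct = the landed theorem verbatim, fine conjunct = its transport, same witnesses).
RECIPE for any further fine edition (successors): ~15 tactic lines per theorem, pattern of §2–§4 (`delta` outer wrappers before inner ones; name the `generalize_proofs`
hypotheses and `revert` exactly those whose type mentions `L ^ (r + kk)`).

WHAT THIS FILE PROVES (kernel).
* §1 `cvBlk_comp_kingPrV` [folklore]: the two-grid files' fine bond block map `cvBlk ∘ kingPrV L k r` (n15-c∕324∕326) IS `blockOf (L^r·L^k)` (`CovAvg.blockOf_kingPr`), so the
  fine conjuncts below are stated in THAT block norm (`BlockNorm.ofBlocks (unitTorusGeo L k (cvM)) (liftBlk (cvBlk ∘ kingPrV L k r (cvM)) ι)`).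
* §2 ★★★ `hasMaj_cGreen_jet_of_reg335Box2_twoGrid`: n15-c∕278 (entries 0 and `∇_U G′(U)` of (3.42) for `U` in the per-cube class on the two-collar boxes) on both grids, one
  block `δ, w₀, R₀, B₀, B₂, c_J`.
* §3 ★★★★ `exists_inverse_decay_of_reg335Cube_twoGrid`: n15-c∕321 (`Reg335Cube` on the locality boxes `□⁺_k`, `C∕ξ, C∕ξ² ≤ ε₀(e)`, `L^m ≥ w₂(e)` ⟹ a two-sided inverse of
  `Δ_{R_U} + (N_L − N_V^Q(U) − N_V^R(U))` with `HasMaj ≤ B e^{−(δ∕16)d}`) for the coarse field `U` on `ScX … k` AND for any fine field `U′` on `ScX' … k r` (spacing `L^{−r}L^{−k}`,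
  fine objects `cvNL'`∕`cvNVq'`∕`cvNVr'`), SAME `δ, B, ε₀, w₂`, every `k ≥ 1`, every `r`.
* §4 ★★★ `exists_inverse_kernelDecay_of_reg335Cube_twoGrid`: n15-c∕323 (kernel currency `|G(δ_z)(x₂)| ≤ B e^{−(δ∕16)|B(x₂) − B(z)|_T}`) likewise, the fine blocks read through
  `kingPrV` (`B(π x′)`).

HONEST FRAMING ∕ LIMITS.  Transport only: the fine conjuncts are the landed coarse theorems at index `r + k`, re-typed on the fine carriers of the pairing; no analytic input;
the two grids' fields `U`, `U′` are INDEPENDENT here (no pairing relation, no η-defect — that is (PC-E) proper, whose pairing∕transport design is the planner's, HOME HANDOFF § g30);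
MODEL carriers (the doubled-cube torus cover, one averaging level, unit weights, per-cube gauges from r06's `Reg335Cube`); [Balaban1985BackgroundPropagators] Thm 3.1∕3.3 pp.397–398,
(3.35) p.396, Sect. C pp.408–410 = SHAPES ∕ MECHANISM, nothing printed is asserted; [King1986] p.664 = the pairing convention only.  NE2⁺ NOT PRINTED, NOT proved; N15 of
record untouched (DISCHARGED AS CONSUMED, p687738); K3⁸ OPEN; counts of record UNMOVED (typed 28∕28 · discharged 8∕27); one finite 𝕋⁴ at fixed ε per index — NOT infinite
volume, NOT OS on ℝ⁴, NOT a mass gap, NOT Clay; R4 closes the conditional finite-𝕋⁴ rung `BalabanLadder.UV` only.  Restate-immune (no Theses import).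
-/

noncomputable section

open scoped BigOperators Matrix Matrix.Norms.L2Operator

namespace Summit.QuantumFields.YangMills.BalabanUVNodes.N15.Gluing

open Real
open Literature.MathematicalPhysics.QuantumFieldTheory.Balaban1983to89
open Literature.MathematicalPhysics.QuantumFieldTheory.Balaban1983to89.B5Prop11Plancherel (Tor fine unitVec)
open Literature.MathematicalPhysics.QuantumFieldTheory.Balaban1983to89.B11SectG (BlockNorm HasMaj)
open Literature.MathematicalPhysics.QuantumFieldTheory.Balaban1983to89.B6UnitTorusCarrier (unitTorusGeo)
open Literature.MathematicalPhysics.QuantumFieldTheory.Balaban1983to89.B9Eq335RegularityClasses (Reg335Cube)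
open Literature.MathematicalPhysics.QuantumFieldTheory.Balaban1983to89.T4EtaRateCoeffDefect (pull)
open Literature.MathematicalPhysics.QuantumFieldTheory.King1986 (aK)
open Literature.MathematicalPhysics.QuantumFieldTheory.King1986.Torus (blockOf)
open Literature.Barriers.QuantumFields (traceForm)
open Summit.QuantumFields.YangMills.BalabanUVNodes.N15.BackgroundLayer (covLapM)
open Summit.QuantumFields.YangMills.BalabanUVNodes.N15.MatrixSpecies (coordMat basisConst liftBlk)
open Summit.QuantumFields.YangMills.BalabanUVNodes.N15.VectorPiece (bshiftEquiv kingPr kingPrV)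
open Summit.QuantumFields.YangMills.BalabanUVNodes.N15.TwoGrid (cubeBlocks)
open Summit.QuantumFields.YangMills.BalabanUVNodes.N15.CurvedSpecies (gaugePair)
open Summit.QuantumFields.YangMills.BalabanUVNodes.N15.CovLandau (cgrad cGreen)

variable {d : ℕ} {L : ℕ} [NeZero L]

/-! ## §1 The fine bond block map of the two-grid files is `blockOf (L^r·L^k)` -/

/-- `B(π b′) = B′(b′)`: the two-grid files' fine bond block map `cvBlk ∘ kingPrV L k r` is the unit-block map of the fine torus. [cite: King1986, p.664 («x′ ∈ Bⁿ(x)»)] -/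
theorem cvBlk_comp_kingPrV (mv kk r : ℕ) (hL : Odd L ∧ 1 < L) :
    (cvBlk d L mv kk hL ∘ kingPrV L kk r (cvM d L mv kk hL)) = fun b : CvX' d L mv kk r hL => blockOf (L ^ r * L ^ kk) (cvM d L mv kk hL) b.1 :=
  funext fun b => CovAvg.blockOf_kingPr (cvM d L mv kk hL) L kk r b.1

/-! ## §2 Entries 0 and `∇_U G′(U)` of (3.42) per cube, on both grids -/

section Jet

/-- ★★★ **n15-c∕278 ON BOTH GRIDS OF THE PAIRING, ONE CONSTANT BLOCK**: for `U` (coarse, spacing `L^{−k}`) resp. `U′` (fine, spacing `L^{−r}L^{−k}`) in the per-cube class (3.35)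
on the two-collar boxes, `G′ = (Δ′_a)⁻¹` and `∇_U G′` decay in dag-n15-w3's block norm with the SAME `δ, B₀, B₂, c_J` and the same thresholds `w₀, R₀` (coarse conjunct =
n15-c∕278 verbatim; fine conjunct = its transport from index `r + k`). [cite: Balaban1985BackgroundPropagators, (3.42) p.397 entries 0–1 with (3.35) p.396 per cube (shape);
King1986, p.664 (pairing)] -/
theorem hasMaj_cGreen_jet_of_reg335Box2_twoGrid (hL : Odd L ∧ 1 < L) (hL7 : 7 ≤ L) {a₀ : ℝ} (ha₀ : 0 < a₀) (ι : Type) [Fintype ι] [DecidableEq ι] :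
    ∃ δ w₀ R₀ B₀ B₂ cJ : ℝ, 0 < δ ∧ 0 < R₀ ∧ 0 < B₀ ∧ 0 < B₂ ∧ 0 ≤ cJ ∧
      (∀ (mv kk : ℕ), 1 ≤ kk → w₀ ≤ ((L ^ mv : ℕ) : ℝ) →
      ∀ {mm : Type} [Fintype mm] [DecidableEq mm] [Nonempty mm] (e : Matrix mm mm ℂ ≃L[ℝ] (ι → ℝ)), (∀ A B : Matrix mm mm ℂ, traceForm A B = e A ⬝ᵥ e B) →
      ∀ (U : Fin (d + 1) → ScX d L mv kk hL → (Matrix mm mm ℂ)ˣ), (∀ μ x, (U μ x : Matrix mm mm ℂ) ∈ Matrix.unitaryGroup mm ℂ) →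
      ∀ (ξ C : ℝ), 0 < ξ → 0 ≤ C →
        (∀ k, Reg335Cube (scShift d L mv kk hL) U ((((L ^ kk : ℕ) : ℝ))⁻¹) {x : ScX d L mv kk hL | blockOf (L ^ kk) (cvM d L mv kk hL) x ∈ cubeBlocks (cvM d L mv kk hL) (coverCorner (cvM d L mv kk hL) (L ^ mv) L (2 * L ^ mv + 2) k) (6 * L ^ mv + 5)} ξ C) →
      ∀ (rV : ℝ), 0 ≤ rV →
        Fintype.card ι * (@basisConst ι _ (Matrix mm mm ℂ) Matrix.frobeniusNormedAddCommGroup Matrix.frobeniusNormedSpace e * (2 * Real.sqrt (Fintype.card mm)) * (Real.sqrt (Fintype.card mm) * ((C / ξ) * Real.exp (((((L ^ kk : ℕ) : ℝ))⁻¹) * (C / ξ))))) ≤ rV →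
        Fintype.card ι * (Fintype.card (Fin (d + 1)) * (Fintype.card ι * (@basisConst ι _ (Matrix mm mm ℂ) Matrix.frobeniusNormedAddCommGroup Matrix.frobeniusNormedSpace e * (2 * Real.sqrt (Fintype.card mm)) * (Real.sqrt (Fintype.card mm) * ((C / ξ) * Real.exp (((((L ^ kk : ℕ) : ℝ))⁻¹) * (C / ξ))))) ^ 2 + @basisConst ι _ (Matrix mm mm ℂ) Matrix.frobeniusNormedAddCommGroup Matrix.frobeniusNormedSpace e * (2 * Real.sqrt (Fintype.card mm)) * (Real.sqrt (Fintype.card mm) * ((C / ξ ^ 2) * Real.exp (((((L ^ kk : ℕ) : ℝ))⁻¹) * (C / ξ)))))) ≤ rV →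
        rV * (1 + Fintype.card (Fin (d + 1) ⊕ Fin (d + 1))) + a₀ * (Fintype.card ι * (Fintype.card ι * ((1 + rV * ((((L ^ kk : ℕ) : ℝ))⁻¹)) ^ ((d + 1) * L ^ kk) - 1) ^ 2 + 2 * ((1 + rV * ((((L ^ kk : ℕ) : ℝ))⁻¹)) ^ ((d + 1) * L ^ kk) - 1))) ≤ R₀ →
        HasMaj (ScNorm d L mv kk hL ι) (ScNorm d L mv kk hL ι)
            (Matrix.mulVecLin (cGreen (cvM d L mv kk hL) (L ^ kk) (cvT e (fun μ x => (U μ x : Matrix mm mm ℂ))) (aK a₀ (L : ℝ) kk * (((L ^ kk : ℕ) : ℝ)) ^ (d + 1))))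
          (fun y y' => B₀ * Real.exp (-(δ / 16 * (unitTorusGeo L kk (cvM d L mv kk hL)).dist y y'))) ∧
        ∀ μ : Fin (d + 1), HasMaj (ScNorm d L mv kk hL ι) (ScNorm d L mv kk hL ι)
          (pull (fun p : ScX d L mv kk hL × ι => ((p.1, μ), p.2)) ∘ₗ
            Matrix.mulVecLin (cgrad (cvM d L mv kk hL) (L ^ kk) (cvT e (fun μ x => (U μ x : Matrix mm mm ℂ))) * cGreen (cvM d L mv kk hL) (L ^ kk) (cvT e (fun μ x => (U μ x : Matrix mm mm ℂ))) (aK a₀ (L : ℝ) kk * (((L ^ kk : ℕ) : ℝ)) ^ (d + 1))))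
          (fun y y' => (1 * (1 + rV * cJ) + π) * B₂ * Real.exp (-(δ / 16 * (unitTorusGeo L kk (cvM d L mv kk hL)).dist y y')))) ∧
      (∀ (mv kk r : ℕ), 1 ≤ kk → w₀ ≤ ((L ^ mv : ℕ) : ℝ) →
      ∀ {mm : Type} [Fintype mm] [DecidableEq mm] [Nonempty mm] (e : Matrix mm mm ℂ ≃L[ℝ] (ι → ℝ)), (∀ A B : Matrix mm mm ℂ, traceForm A B = e A ⬝ᵥ e B) →
      ∀ (U : Fin (d + 1) → ScX' d L mv kk r hL → (Matrix mm mm ℂ)ˣ), (∀ μ x, (U μ x : Matrix mm mm ℂ) ∈ Matrix.unitaryGroup mm ℂ) →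
      ∀ (ξ C : ℝ), 0 < ξ → 0 ≤ C →
        (∀ k, Reg335Cube (scShift' d L mv kk r hL) U ((((L ^ r * L ^ kk : ℕ) : ℝ))⁻¹) {x : ScX' d L mv kk r hL | blockOf (L ^ r * L ^ kk) (cvM d L mv kk hL) x ∈ cubeBlocks (cvM d L mv kk hL) (coverCorner (cvM d L mv kk hL) (L ^ mv) L (2 * L ^ mv + 2) k) (6 * L ^ mv + 5)} ξ C) →
      ∀ (rV : ℝ), 0 ≤ rV →
        Fintype.card ι * (@basisConst ι _ (Matrix mm mm ℂ) Matrix.frobeniusNormedAddCommGroup Matrix.frobeniusNormedSpace e * (2 * Real.sqrt (Fintype.card mm)) * (Real.sqrt (Fintype.card mm) * ((C / ξ) * Real.exp (((((L ^ r * L ^ kk : ℕ) : ℝ))⁻¹) * (C / ξ))))) ≤ rV →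
        Fintype.card ι * (Fintype.card (Fin (d + 1)) * (Fintype.card ι * (@basisConst ι _ (Matrix mm mm ℂ) Matrix.frobeniusNormedAddCommGroup Matrix.frobeniusNormedSpace e * (2 * Real.sqrt (Fintype.card mm)) * (Real.sqrt (Fintype.card mm) * ((C / ξ) * Real.exp (((((L ^ r * L ^ kk : ℕ) : ℝ))⁻¹) * (C / ξ))))) ^ 2 + @basisConst ι _ (Matrix mm mm ℂ) Matrix.frobeniusNormedAddCommGroup Matrix.frobeniusNormedSpace e * (2 * Real.sqrt (Fintype.card mm)) * (Real.sqrt (Fintype.card mm) * ((C / ξ ^ 2) * Real.exp (((((L ^ r * L ^ kk : ℕ) : ℝ))⁻¹) * (C / ξ)))))) ≤ rV →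
        rV * (1 + Fintype.card (Fin (d + 1) ⊕ Fin (d + 1))) + a₀ * (Fintype.card ι * (Fintype.card ι * ((1 + rV * ((((L ^ r * L ^ kk : ℕ) : ℝ))⁻¹)) ^ ((d + 1) * (L ^ r * L ^ kk)) - 1) ^ 2 + 2 * ((1 + rV * ((((L ^ r * L ^ kk : ℕ) : ℝ))⁻¹)) ^ ((d + 1) * (L ^ r * L ^ kk)) - 1))) ≤ R₀ →
        HasMaj (ScNorm' d L mv kk r hL ι) (ScNorm' d L mv kk r hL ι)
            (Matrix.mulVecLin (cGreen (cvM d L mv kk hL) (L ^ r * L ^ kk) (cvT e (fun μ x => (U μ x : Matrix mm mm ℂ))) (aK a₀ (L : ℝ) (r + kk) * (((L ^ r * L ^ kk : ℕ) : ℝ)) ^ (d + 1))))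
          (fun y y' => B₀ * Real.exp (-(δ / 16 * (unitTorusGeo L kk (cvM d L mv kk hL)).dist y y'))) ∧
        ∀ μ : Fin (d + 1), HasMaj (ScNorm' d L mv kk r hL ι) (ScNorm' d L mv kk r hL ι)
          (pull (fun p : ScX' d L mv kk r hL × ι => ((p.1, μ), p.2)) ∘ₗ
            Matrix.mulVecLin (cgrad (cvM d L mv kk hL) (L ^ r * L ^ kk) (cvT e (fun μ x => (U μ x : Matrix mm mm ℂ))) * cGreen (cvM d L mv kk hL) (L ^ r * L ^ kk) (cvT e (fun μ x => (U μ x : Matrix mm mm ℂ))) (aK a₀ (L : ℝ) (r + kk) * (((L ^ r * L ^ kk : ℕ) : ℝ)) ^ (d + 1))))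
          (fun y y' => (1 * (1 + rV * cJ) + π) * B₂ * Real.exp (-(δ / 16 * (unitTorusGeo L kk (cvM d L mv kk hL)).dist y y')))) := by
  obtain ⟨δ, w₀, R₀, B₀, B₂, cJ, hδ, hR₀, hB₀, hB₂, hcJ, H⟩ := hasMaj_cGreen_jet_of_reg335Box2 (d := d) hL hL7 ha₀ ι
  refine ⟨δ, w₀, R₀, B₀, B₂, cJ, hδ, hR₀, hB₀, hB₂, hcJ, H, fun mv kk r hk hw₀ => ?_⟩
  intro mm _ _ _ e he U hU ξ C hξ hC h335 rV hrV hrA hrC hRle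
  delta ScNorm scShift at H
  delta scBlk at H
  delta ScX at H
  have H1 := @H mv (r + kk) (hk.trans (Nat.le_add_left kk r)) hw₀ mm _ _ _ e he
  clear H
  generalize_proofs p0 p1 p2 p3 p4 p5 p6 at H1
  revert p2 p4 H1
  rw [show L ^ (r + kk) = L ^ r * L ^ kk from pow_add L r kk]
  intro p2 p4 H1
  exact H1 U hU ξ C hξ hC h335 rV hrV hrA hrC hRle

end Jet

/-! ## §3 Bałaban's operator inverted with decay per cube, on both grids -/

section Inverse

/-- ★★★★ **n15-c∕321 ON BOTH GRIDS OF THE PAIRING, ONE CONSTANT BLOCK**: with `δ, B` (and, per colour chart `e`, `ε₀, w₂`) FIXED ONCE, for every index `k ≥ 1`, every `r`, every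
`U(m)`-valued site bond field `U` on the coarse torus resp. `U′` on the fine torus lying in r06's `Reg335Cube` on the locality boxes `□⁺_k` with `C∕ξ, C∕ξ² ≤ ε₀`, `L^m ≥ w₂`:
Bałaban's operator `Δ_{R_U} + (N_L − N_V^Q(U) − N_V^R(U))` (coarse objects `cvNL∕cvNVq∕cvNVr`, spacing `L^{−k}`) resp. `Δ_{R_U′} + (N′_L − N_V^Q′(U′) − N_V^R′(U′))` (fine objects
`cvNL'∕cvNVq'∕cvNVr'`, spacing `L^{−r}L^{−k}`) has a two-sided inverse with `HasMaj ≤ B e^{−(δ∕16)d}` in the block norm of the respective grid (fine blocks read through `kingPrV`).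
Coarse conjunct = n15-c∕321 verbatim; fine conjunct = its transport from index `r + k`. [cite: Balaban1985BackgroundPropagators, Thm 3.3 p.398 with (3.35) p.396 per cube, Sect. C
(3.87)–(3.90) pp.409–410 (mechanism); King1986, p.664 (pairing)] -/
theorem exists_inverse_decay_of_reg335Cube_twoGrid (hL : Odd L ∧ 1 < L) (hL17 : 17 ≤ L) {a₀ : ℝ} (ha₀ : 0 < a₀) {a : ℝ} (ha : 0 < a) (ι : Type) [Fintype ι] [DecidableEq ι] :
    ∃ δ B : ℝ, 0 < δ ∧ 0 < B ∧
      ∀ {mm : Type} [Fintype mm] [DecidableEq mm] [Nonempty mm] (e : Matrix mm mm ℂ ≃L[ℝ] (ι → ℝ)), (∀ A B : Matrix mm mm ℂ, traceForm A B = e A ⬝ᵥ e B) →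
      ∃ ε₀ w₂ : ℝ, 0 < ε₀ ∧
      (∀ (mv kk : ℕ), 1 ≤ kk → w₂ ≤ ((L ^ mv : ℕ) : ℝ) →
      ∀ (U : Fin (d + 1) → ScX d L mv kk hL → (Matrix mm mm ℂ)ˣ), (∀ μ x, (U μ x : Matrix mm mm ℂ) ∈ Matrix.unitaryGroup mm ℂ) →
      ∀ (ξ C : ℝ), 0 < ξ → 0 < C → C / ξ ≤ ε₀ → C / ξ ^ 2 ≤ ε₀ →
        (∀ k : Fin (d + 1) → ZMod (2 * L), Reg335Cube (scShift d L mv kk hL) U ((((L ^ kk : ℕ) : ℝ))⁻¹) {x : ScX d L mv kk hL | blockOf (L ^ kk) (cvM d L mv kk hL) x ∈ cubeBlocks (cvM d L mv kk hL) (coverCorner (cvM d L mv kk hL) (L ^ mv) L (L * L ^ mv + 6 * L ^ mv - coverMargin L mv + 1) k) (L * L ^ mv + 16 * L ^ mv + 4)} ξ C) →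
        ∃ G : (CvX d L mv kk hL × ι → ℝ) →ₗ[ℝ] (CvX d L mv kk hL × ι → ℝ),
          HasMaj (CvNorm d L mv kk hL ι) (CvNorm d L mv kk hL ι) G (fun y y' => B * Real.exp (-(δ / 16 * (unitTorusGeo L kk (cvM d L mv kk hL)).dist y y'))) ∧
          G ∘ₗ (covLapM (bshiftEquiv (cvM d L mv kk hL) (L ^ kk)) ((((L ^ kk : ℕ) : ℝ))⁻¹) (gaugePair (bshiftEquiv (cvM d L mv kk hL) (L ^ kk)) (fun μ x => coordMat e (ContinuousLinearMap.mulLeftRight ℝ (Matrix mm mm ℂ) ((U μ x.1 : Matrix mm mm ℂ)) ((U μ x.1 : Matrix mm mm ℂ))ᴴ))) + (cvNL d L mv kk hL a ι - cvNVq d L mv kk hL a ι e (fun μ x => (U μ x.1 : Matrix mm mm ℂ)) - cvNVr d L mv kk hL a ι e (fun μ x => (U μ x.1 : Matrix mm mm ℂ)))) = LinearMap.id ∧ (covLapM (bshiftEquiv (cvM d L mv kk hL) (L ^ kk)) ((((L ^ kk : ℕ) : ℝ))⁻¹) (gaugePair (bshiftEquiv (cvM d L mv kk hL) (L ^ kk))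 (fun μ x => coordMat e (ContinuousLinearMap.mulLeftRight ℝ (Matrix mm mm ℂ) ((U μ x.1 : Matrix mm mm ℂ)) ((U μ x.1 : Matrix mm mm ℂ))ᴴ))) + (cvNL d L mv kk hL a ι - cvNVq d L mv kk hL a ι e (fun μ x => (U μ x.1 : Matrix mm mm ℂ)) - cvNVr d L mv kk hL a ι e (fun μ x => (U μ x.1 : Matrix mm mm ℂ)))) ∘ₗ G = LinearMap.id) ∧
      (∀ (mv kk r : ℕ), 1 ≤ kk → w₂ ≤ ((L ^ mv : ℕ) : ℝ) →
      ∀ (U : Fin (d + 1) → ScX' d L mv kk r hL → (Matrix mm mm ℂ)ˣ), (∀ μ x, (U μ x : Matrix mm mm ℂ) ∈ Matrix.unitaryGroup mm ℂ) →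
      ∀ (ξ C : ℝ), 0 < ξ → 0 < C → C / ξ ≤ ε₀ → C / ξ ^ 2 ≤ ε₀ →
        (∀ k : Fin (d + 1) → ZMod (2 * L), Reg335Cube (scShift' d L mv kk r hL) U ((((L ^ r * L ^ kk : ℕ) : ℝ))⁻¹) {x : ScX' d L mv kk r hL | blockOf (L ^ r * L ^ kk) (cvM d L mv kk hL) x ∈ cubeBlocks (cvM d L mv kk hL) (coverCorner (cvM d L mv kk hL) (L ^ mv) L (L * L ^ mv + 6 * L ^ mv - coverMargin L mv + 1) k) (L * L ^ mv + 16 * L ^ mv + 4)} ξ C) →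
        ∃ G : (CvX' d L mv kk r hL × ι → ℝ) →ₗ[ℝ] (CvX' d L mv kk r hL × ι → ℝ),
          HasMaj (BlockNorm.ofBlocks (unitTorusGeo L kk (cvM d L mv kk hL)) (liftBlk (cvBlk d L mv kk hL ∘ kingPrV L kk r (cvM d L mv kk hL)) ι)) (BlockNorm.ofBlocks (unitTorusGeo L kk (cvM d L mv kk hL)) (liftBlk (cvBlk d L mv kk hL ∘ kingPrV L kk r (cvM d L mv kk hL)) ι)) G (fun y y' => B * Real.exp (-(δ / 16 * (unitTorusGeo L kk (cvM d L mv kk hL)).dist y y'))) ∧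
          G ∘ₗ (covLapM (bshiftEquiv (cvM d L mv kk hL) (L ^ r * L ^ kk)) ((((L ^ r * L ^ kk : ℕ) : ℝ))⁻¹) (gaugePair (bshiftEquiv (cvM d L mv kk hL) (L ^ r * L ^ kk)) (fun μ x => coordMat e (ContinuousLinearMap.mulLeftRight ℝ (Matrix mm mm ℂ) ((U μ x.1 : Matrix mm mm ℂ)) ((U μ x.1 : Matrix mm mm ℂ))ᴴ))) + (cvNL' d L mv kk r hL a ι - cvNVq' d L mv kk r hL a ι e (fun μ x => (U μ x.1 : Matrix mm mm ℂ)) - cvNVr' d L mv kk r hL a ι e (fun μ x => (U μ x.1 : Matrix mm mm ℂ)))) = LinearMap.id ∧ (covLapM (bshiftEquiv (cvM d L mv kk hL) (L ^ r * L ^ kk)) ((((L ^ r * L ^ kk : ℕ) : ℝ))⁻¹) (gaugePair (bshiftEquiv (cvM d L mv kk hL) (L ^ r * L ^ kk)) (fun μ x => coordMat e (ContinuousLinearMap.mulLeftRight ℝ (Matrix mm mm ℂ) ((U μ x.1 : Matrix mm mm ℂ)) ((U μ x.1 : Matrix mm mm ℂ))ᴴ))) + (cvNL' d L mv kk r hL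 a ι - cvNVq' d L mv kk r hL a ι e (fun μ x => (U μ x.1 : Matrix mm mm ℂ)) - cvNVr' d L mv kk r hL a ι e (fun μ x => (U μ x.1 : Matrix mm mm ℂ)))) ∘ₗ G = LinearMap.id) := by
  obtain ⟨δ, B, hδ, hB, H⟩ := exists_inverse_decay_of_reg335Cube (d := d) hL hL17 ha₀ ha ι
  refine ⟨δ, B, hδ, hB, fun {mm} _ _ _ e he => ?_⟩
  obtain ⟨ε₀, w₂, hε₀, H'⟩ := H e he
  refine ⟨ε₀, w₂, hε₀, H', fun mv kk r hk hw U hU ξ C hξ hC h1 h2 h335 => ?_⟩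
  delta CvNorm at H'
  delta cvNVr cvNVq cvNL at H'
  delta cvLandau cvBlk scShift at H'
  delta CvX ScX at H'
  have H1 := @H' mv (r + kk) (hk.trans (Nat.le_add_left kk r)) hw
  clear H' H
  rw [cvBlk_comp_kingPrV]
  delta cvNVr' cvNVq' cvNL'
  delta cvLandau'
  generalize_proofs p0 p1 p2 p3 p4 p5 p6 p7 p8 p9 p10 p11 p12 p13 p14 p15 p16 p17 p18 p19 p20 p21 at H1
  revert p2 p3 p20 p21 H1
  rw [show L ^ (r + kk) = L ^ r * L ^ kk from pow_add L r kk]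
  intro p2 p3 p20 p21 H1
  exact H1 U hU ξ C hξ hC h1 h2 h335

end Inverse

/-! ## §4 The same in the kernel currency -/

section Kernel

/-- ★★★ **n15-c∕323 ON BOTH GRIDS OF THE PAIRING, ONE CONSTANT BLOCK**: §3 read as matrix entries, `|G(δ_z)(x₂)| ≤ B e^{−(δ∕16)|B(x₂) − B(z)|_T}` on the coarse grid and
`|G′(δ_z′)(x′₂)| ≤ B e^{−(δ∕16)|B(πx′₂) − B(πz′)|_T}` on the fine grid, same `δ, B, ε₀, w₂`. [cite: Balaban1985BackgroundPropagators, Thm 3.3 p.398 (kernel form, shape); King1986,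
p.664 (pairing)] -/
theorem exists_inverse_kernelDecay_of_reg335Cube_twoGrid (hL : Odd L ∧ 1 < L) (hL17 : 17 ≤ L) {a₀ : ℝ} (ha₀ : 0 < a₀) {a : ℝ} (ha : 0 < a) (ι : Type) [Fintype ι] [DecidableEq ι] :
    ∃ δ B : ℝ, 0 < δ ∧ 0 < B ∧
      ∀ {mm : Type} [Fintype mm] [DecidableEq mm] [Nonempty mm] (e : Matrix mm mm ℂ ≃L[ℝ] (ι → ℝ)), (∀ A B : Matrix mm mm ℂ, traceForm A B = e A ⬝ᵥ e B) →
      ∃ ε₀ w₂ : ℝ, 0 < ε₀ ∧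
      (∀ (mv kk : ℕ), 1 ≤ kk → w₂ ≤ ((L ^ mv : ℕ) : ℝ) →
      ∀ (U : Fin (d + 1) → ScX d L mv kk hL → (Matrix mm mm ℂ)ˣ), (∀ μ x, (U μ x : Matrix mm mm ℂ) ∈ Matrix.unitaryGroup mm ℂ) →
      ∀ (ξ C : ℝ), 0 < ξ → 0 < C → C / ξ ≤ ε₀ → C / ξ ^ 2 ≤ ε₀ →
        (∀ k : Fin (d + 1) → ZMod (2 * L), Reg335Cube (scShift d L mv kk hL) U ((((L ^ kk : ℕ) : ℝ))⁻¹) {x : ScX d L mv kk hL | blockOf (L ^ kk) (cvM d L mv kk hL) x ∈ cubeBlocks (cvM d L mv kk hL) (coverCorner (cvM d L mv kk hL) (L ^ mv) L (L * L ^ mv + 6 * L ^ mv - coverMargin L mv + 1) k) (L * L ^ mv + 16 * L ^ mv + 4)} ξ C) →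
        ∃ G : (CvX d L mv kk hL × ι → ℝ) →ₗ[ℝ] (CvX d L mv kk hL × ι → ℝ),
          (∀ (z x₂ : CvX d L mv kk hL × ι), |G (Pi.single z 1) x₂| ≤ B * Real.exp (-(δ / 16 * (unitTorusGeo L kk (cvM d L mv kk hL)).dist (cvBlk d L mv kk hL x₂.1) (cvBlk d L mv kk hL z.1)))) ∧
          G ∘ₗ (covLapM (bshiftEquiv (cvM d L mv kk hL) (L ^ kk)) ((((L ^ kk : ℕ) : ℝ))⁻¹) (gaugePair (bshiftEquiv (cvM d L mv kk hL) (L ^ kk)) (fun μ x => coordMat e (ContinuousLinearMap.mulLeftRight ℝ (Matrix mm mm ℂ) ((U μ x.1 : Matrix mm mm ℂ)) ((U μ x.1 : Matrix mm mm ℂ))ᴴ))) + (cvNL d L mv kk hL a ι - cvNVq d L mv kk hL a ι e (fun μ x => (U μ x.1 : Matrix mm mm ℂ)) - cvNVr d L mv kk hL a ι e (fun μ x => (U μ x.1 : Matrix mm mm ℂ)))) = LinearMap.id ∧ (covLapM (bshiftEquiv (cvM d L mv kk hL) (L ^ kk)) ((((L ^ kk : ℕ) : ℝ))⁻¹) (gaugePair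 (bshiftEquiv (cvM d L mv kk hL) (L ^ kk)) (fun μ x => coordMat e (ContinuousLinearMap.mulLeftRight ℝ (Matrix mm mm ℂ) ((U μ x.1 : Matrix mm mm ℂ)) ((U μ x.1 : Matrix mm mm ℂ))ᴴ))) + (cvNL d L mv kk hL a ι - cvNVq d L mv kk hL a ι e (fun μ x => (U μ x.1 : Matrix mm mm ℂ)) - cvNVr d L mv kk hL a ι e (fun μ x => (U μ x.1 : Matrix mm mm ℂ)))) ∘ₗ G = LinearMap.id) ∧
      (∀ (mv kk r : ℕ), 1 ≤ kk → w₂ ≤ ((L ^ mv : ℕ) : ℝ) →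
      ∀ (U : Fin (d + 1) → ScX' d L mv kk r hL → (Matrix mm mm ℂ)ˣ), (∀ μ x, (U μ x : Matrix mm mm ℂ) ∈ Matrix.unitaryGroup mm ℂ) →
      ∀ (ξ C : ℝ), 0 < ξ → 0 < C → C / ξ ≤ ε₀ → C / ξ ^ 2 ≤ ε₀ →
        (∀ k : Fin (d + 1) → ZMod (2 * L), Reg335Cube (scShift' d L mv kk r hL) U ((((L ^ r * L ^ kk : ℕ) : ℝ))⁻¹) {x : ScX' d L mv kk r hL | blockOf (L ^ r * L ^ kk) (cvM d L mv kk hL) x ∈ cubeBlocks (cvM d L mv kk hL) (coverCorner (cvM d L mv kk hL) (L ^ mv) L (L * L ^ mv + 6 * L ^ mv - coverMargin L mv + 1) k) (L * L ^ mv + 16 * L ^ mv + 4)} ξ C) →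
        ∃ G : (CvX' d L mv kk r hL × ι → ℝ) →ₗ[ℝ] (CvX' d L mv kk r hL × ι → ℝ),
          (∀ (z x₂ : CvX' d L mv kk r hL × ι), |G (Pi.single z 1) x₂| ≤ B * Real.exp (-(δ / 16 * (unitTorusGeo L kk (cvM d L mv kk hL)).dist (cvBlk d L mv kk hL (kingPrV L kk r (cvM d L mv kk hL) x₂.1)) (cvBlk d L mv kk hL (kingPrV L kk r (cvM d L mv kk hL) z.1))))) ∧
          G ∘ₗ (covLapM (bshiftEquiv (cvM d L mv kk hL) (L ^ r * L ^ kk)) ((((L ^ r * L ^ kk : ℕ) : ℝ))⁻¹) (gaugePair (bshiftEquiv (cvM d L mv kk hL) (L ^ r * L ^ kk)) (fun μ x => coordMat e (ContinuousLinearMap.mulLeftRight ℝ (Matrix mm mm ℂ) ((U μ x.1 : Matrix mm mm ℂ)) ((U μ x.1 : Matrix mm mm ℂ))ᴴ))) + (cvNL' d L mv kk r hL a ι - cvNVq' d L mv kk r hL a ι e (fun μ x => (U μ x.1 : Matrix mm mm ℂ)) - cvNVr' d L mv kk r hL a ι e (fun μ x => (U μ x.1 : Matrix mm mm ℂ))))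 = LinearMap.id ∧ (covLapM (bshiftEquiv (cvM d L mv kk hL) (L ^ r * L ^ kk)) ((((L ^ r * L ^ kk : ℕ) : ℝ))⁻¹) (gaugePair (bshiftEquiv (cvM d L mv kk hL) (L ^ r * L ^ kk)) (fun μ x => coordMat e (ContinuousLinearMap.mulLeftRight ℝ (Matrix mm mm ℂ) ((U μ x.1 : Matrix mm mm ℂ)) ((U μ x.1 : Matrix mm mm ℂ))ᴴ))) + (cvNL' d L mv kk r hL a ι - cvNVq' d L mv kk r hL a ι e (fun μ x => (U μ x.1 : Matrix mm mm ℂ)) - cvNVr' d L mv kk r hL a ι e (fun μ x => (U μ x.1 : Matrix mm mm ℂ)))) ∘ₗ G = LinearMap.id) := by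
  obtain ⟨δ, B, hδ, hB, H⟩ := exists_inverse_kernelDecay_of_reg335Cube (d := d) hL hL17 ha₀ ha ι
  refine ⟨δ, B, hδ, hB, fun {mm} _ _ _ e he => ?_⟩
  obtain ⟨ε₀, w₂, hε₀, H'⟩ := H e he
  refine ⟨ε₀, w₂, hε₀, H', fun mv kk r hk hw U hU ξ C hξ hC h1 h2 h335 => ?_⟩
  delta cvNVr cvNVq cvNL at H'
  delta cvLandau cvBlk scShift at H'
  delta CvX ScX at H'
  have H1 := @H' mv (r + kk) (hk.trans (Nat.le_add_left kk r)) hw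
  clear H' H
  simp only [VectorPiece.kingPrV_eq, cvBlk, CovAvg.blockOf_kingPr]
  delta cvNVr' cvNVq' cvNL'
  delta cvLandau'
  generalize_proofs p0 p1 p2 p3 p4 p5 p6 p7 p8 p9 p10 p11 p12 p13 p14 p15 p16 p17 p18 p19 p20 p21 at H1
  revert p2 p19 p20 p21 H1
  rw [show L ^ (r + kk) = L ^ r * L ^ kk from pow_add L r kk]
  intro p2 p19 p20 p21 H1
  exact H1 U hU ξ C hξ hC h1 h2 h335

end Kernel

end Summit.QuantumFields.YangMills.BalabanUVNodes.N15.Gluing
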